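import Literature.NumberTheory.NumberFields.CubicFieldDedekindKummer
import Literature.NumberTheory.NumberFields.IntegralBasisIndex
import Mathlib.Tactic.NormNum.Prime
import HarnessLib

/-!
# The cubic field of discriminant `−1727`: `F = ℚ(θ)`, `θ³ − θ − 16 = 0`, `𝓞_F = ℤ ⊕ ℤθ ⊕ ℤδ`, `δ = (θ² + θ)/2`
# — a field with NO power integral basis at all (`2` is totally split: Dedekind's common index divisor), `d_F = −1727 = −11·157`,
# signature `(1, 1)`, norm form on `(1, θ, δ)` — PROVED

Topic `Literature/NumberTheory/CubicFields`, namespace `Literature.NumberTheory.CubicFields.CubicDisc1727`.  THEOREMS ONLY (no definition, no named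
fact, no instance, no notation); every statement is PROVED.  Written by the prover seat `bsd-line-att-p3` g55 (cell `bsd-f1-sign2`) on the TWO-GENERATOR
template of `CubicFieldDiscriminant7683.lean` (att-p4 g44), for the cubic `2`-division field `ℚ(β)` of the elliptic curves `1727a1`, `29359b1`, `29359d1`
(`θ = 312 − (55/2)β − 6β²` for `1727a1 = [1, −1, 0, −76, 275]`): the SPLIT-STRATUM field with `rank₂ Cl(F(√2)) = 2` of crux C2's census (route
`AlignedTransportAtTwo`).  Here `2 = 𝔭_A 𝔭_B 𝔭_C` is TOTALLY SPLIT, so EVERY element of `𝓞_F ∖ ℤ` has even index (Dedekind 1878; the index form takes the values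
`2, 2, 4, 4, 10, 16, …` near the origin) and Dedekind–Kummer is NOT available at `p = 2` through any generator: `𝓞_F` is presented as `ℤ ⊕ ℤθ ⊕ ℤδ` with
`f(θ) = 0`, `f = X³ − X − 16` (`Δ(f) = −6908 = 2²·(−1727)`, index `2`) and `δ = (θ² + θ)/2`, `g(δ) = 0`, `g = X³ − X² − 12X − 32` (`Δ(g) = 4²·(−1727)`);
the discriminant is computed WITHOUT a second coprime index: the index determinant of `1, θ, θ²` divides `2` (`IntegralBasisIndex`) and is NOT a unit because
the algebraic integer `δ` is not in `ℤ[θ]` (a polynomial of degree `≤ 2` with odd `X²`-coefficient numerator would vanish at `θ`), so it is `±2` and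
`d_F = −6908/4 = −1727`.  The primes above `2` are handled in the sequel by three PRIME ELEMENTS `π_A π_B π_C = 2` and the norm form (no residue map at `2`).

## Source

[LMFDB] The L-functions and Modular Forms Database, number field `3.1.1727.1` (degree `3`, signature `[1, 1]`, discriminant `−1727`, class number `1`)
and elliptic curves `1727.a1`, `29359.b1`, `29359.d1`.  D. A. Marcus, *Number Fields*, 2nd ed. (2018) [Marcus2018], Ch. 2 Ex. 27 (index / discriminant),
Ch. 2 Thm. 4 (norm as a determinant), Ch. 3 Thm. 27 (Dedekind–Kummer), Ch. 5 Thm. 37 (Minkowski).  R. Dedekind, *Über den Zusammenhang zwischen der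
Theorie der Ideale und der Theorie der höheren Congruenzen*, Abh. Göttingen 23 (1878) (the common index divisor).

## Carrier

`F` is ANY number field with `[F : ℚ] = 3` containing `α` with `aeval α (MonicCubic.poly 0 (−1) (−16)) = 0`; `θ := MonicCubic.thetaInt hα ∈ 𝓞 F`
and `δ := MonicCubic.thetaInt (delta_root hα) ∈ 𝓞 F` (the algebraic integer `(α² + α)/2`).

## What is formalised (all PROVED)

* §1 the polynomials: `disc_eq` (`Δ(f) = 2²·(−1727)`), `squarefree_neg_1727`, `no_root_3` / `irreducible_polyQ` (`3` inert); `cubic_eq`; `delta_root`,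
  `disc_delta_eq` (`Δ(g) = 4²·(−1727)`), `no_root_3_delta` / `irreducible_polyQ_delta`; `polyMod_eq` and the factorisations `f mod 5, 11` (`5 = 𝔮𝔮′`,
  `11 = 𝔮₄𝔮₉²` ramified), `no_root_7` (`7` inert).
* §2 the order: `mem2` (**`2·𝓞_F ⊆ ℤ[θ]`**), `not_dvd_exponent` (`p ≠ 2`), `den_delta` / `mul_table` (**`ℤ ⊕ ℤθ ⊕ ℤδ` is a ring**: `θ² = −θ + 2δ`,
  `θδ = 8 + δ`, `δ² = 8 + 4θ + δ`), `coe_lin` / ★ `norm_lin3` (**`N(a + bθ + cδ) = a³ + a²c − ab² − 25abc − 12ac² + 16b³ + 24b²c + 8bc² + 32c³`**),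
  `not_mem_adjoin_delta` (`δ ∉ ℤ[θ]`), ★ `discr_eq` (**`d_F = −1727`**), `nrComplexPlaces_eq_one`.
* The sequel `CubicFieldDiscriminant1727ClassNumber.lean`: the primes of norm `≤ 11` are principal (three prime elements above `2`) and ★ `h_F = 1`.

## References
* [LMFDB] The LMFDB Collaboration, The L-functions and Modular Forms Database, number field 3.1.1727.1; elliptic curves 1727.a1, 29359.b1, 29359.d1.
* [Marcus2018] D. A. Marcus, *Number Fields*, 2nd ed., Universitext, Springer 2018, Ch. 2 Ex. 27 and Thm. 4, Ch. 3 Thm. 27, Ch. 5 Thm. 37.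
* [Dedekind1878] R. Dedekind, Über den Zusammenhang zwischen der Theorie der Ideale und der Theorie der höheren Congruenzen, Abh. Kgl. Ges. Wiss. Göttingen 23 (1878), §5.
-/

noncomputable section

open Polynomial NumberField NumberField.InfinitePlace Ideal Module Real
open Literature.NumberTheory.NumberFields
open Literature.NumberTheory.NumberFields.MonicCubic

namespace Literature.NumberTheory.CubicFields.CubicDisc1727

/-! ## §1 The polynomials `f = MonicCubic.poly 0 (-1) (-16)` (index `2`) and `g = MonicCubic.poly (-1) (-12) (-32)` (index `4`) -/

/-- `Δ(f) = -6908 = 2²·(−1727)`. [cite: LMFDB, number field 3.1.1727.1 (discriminant −1727)] [cite: Marcus2018, Ch. 2, Exercise 27] -/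
theorem disc_eq : disc 0 (-1) (-16) = 2 ^ 2 * (-1727) := by
  norm_num [disc]

/-- `−1727` is squarefree (`1727 = 11·157`). [cite: Marcus2018, Ch. 2, Exercise 27(e)] -/
theorem squarefree_neg_1727 : Squarefree (-1727 : ℤ) := by
  rw [← Int.squarefree_natAbs, show (-1727 : ℤ).natAbs = 1727 by norm_num]
  rw [show (1727 : ℕ) = 11 * 157 by norm_num, Nat.squarefree_mul_iff]
  exact ⟨by norm_num, (by norm_num : Nat.Prime 11).squarefree, (by norm_num : Nat.Prime 157).squarefree⟩

/-- `f` has no root modulo `3` (`3` is inert). [cite: Marcus2018, Ch. 3, Thm. 27] -/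
theorem no_root_3 :
    ∀ r : ZMod 3, r ^ 3 + ((0 : ℤ) : ZMod 3) * r ^ 2 + ((-1 : ℤ) : ZMod 3) * r + ((-16 : ℤ) : ZMod 3) ≠ 0 := by
  decide

/-- **`f` is irreducible over `ℚ`** (no root modulo `3`). [cite: LMFDB, number field 3.1.1727.1 (degree 3)] -/
theorem irreducible_polyQ : Irreducible (polyQ 0 (-1) (-16)) :=
  haveI : Fact (Nat.Prime 3) := ⟨by norm_num⟩
  irreducible_polyQ_of_no_root 3 no_root_3

/-- `f` has no root modulo `7` (`7` is inert). [cite: Marcus2018, Ch. 3, Thm. 27] -/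
theorem no_root_7 :
    ∀ r : ZMod 7, r ^ 3 + ((0 : ℤ) : ZMod 7) * r ^ 2 + ((-1 : ℤ) : ZMod 7) * r + ((-16 : ℤ) : ZMod 7) ≠ 0 := by
  decide

/-- `f mod p` written out. [cite: Marcus2018, Ch. 3, Thm. 27] -/
theorem polyMod_eq (p : ℕ) : polyMod 0 (-1) (-16) p = ((-16) + (-1) * X + (0) * X ^ 2 + X ^ 3 : (ZMod p)[X]) := by
  simp [polyMod, poly]; ring

/-- `f ≡ (X + 3)(X² + 2X + 3) (mod 5)`: `5 = 𝔮𝔮′` with residue degrees `1, 2`. [cite: Marcus2018, Ch. 3, Thm. 27] -/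
theorem polyMod_5 : polyMod 0 (-1) (-16) 5 = (X + 3) * (X ^ 2 + 2 * X + 3) := by
  rw [polyMod_eq]
  have hp : (5 : (ZMod 5)[X]) = 0 := by
    rw [show (5 : (ZMod 5)[X]) = C 5 from (map_natCast C 5).symm, show (5 : ZMod 5) = 0 from rfl, C_0]
  linear_combination ((-5) + (-2) * X + (-1) * X ^ 2 : (ZMod 5)[X]) * hp

/-- `f ≡ (X + 7)(X + 2)² (mod 11)`: `11 = 𝔮₄·𝔮₉²` is (tamely) ramified. [cite: Marcus2018, Ch. 3, Thm. 27] -/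
theorem polyMod_11 : polyMod 0 (-1) (-16) 11 = (X + 7) * (X + 2) * (X + 2) := by
  rw [polyMod_eq]
  have hp : (11 : (ZMod 11)[X]) = 0 := by
    rw [show (11 : (ZMod 11)[X]) = C 11 from (map_natCast C 11).symm, show (11 : ZMod 11) = 0 from rfl, C_0]
  linear_combination ((-4) + (-3) * X + (-1) * X ^ 2 : (ZMod 11)[X]) * hp

/-- `Δ(g) = -27632 = 4²·(−1727)` for `g = X³ − X² − 12X − 32`, the minimal polynomial of `δ`. [cite: Marcus2018, Ch. 2, Exercise 27] -/
theorem disc_delta_eq : disc (-1) (-12) (-32) = 4 ^ 2 * (-1727) := by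
  norm_num [disc]

/-- `g` has no root modulo `3`. [cite: Marcus2018, Ch. 3, Thm. 27] -/
theorem no_root_3_delta :
    ∀ r : ZMod 3, r ^ 3 + ((-1 : ℤ) : ZMod 3) * r ^ 2 + ((-12 : ℤ) : ZMod 3) * r + ((-32 : ℤ) : ZMod 3) ≠ 0 := by
  decide

/-- **`g` is irreducible over `ℚ`** (no root modulo `3`). [cite: LMFDB, number field 3.1.1727.1 (degree 3)] -/
theorem irreducible_polyQ_delta : Irreducible (polyQ (-1) (-12) (-32)) :=
  haveI : Fact (Nat.Prime 3) := ⟨by norm_num⟩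
  irreducible_polyQ_of_no_root 3 no_root_3_delta

/-! ## §2 `𝓞_F = ℤ ⊕ ℤθ ⊕ ℤδ`: the two generators, the exponents, the multiplication table, the norm form, the discriminant -/

section NumberField

variable {F : Type*} [Field F] [NumberField F] {α : F}

omit [NumberField F] in
/-- The cubic relation `f(α) = 0` in `F`. [cite: LMFDB, number field 3.1.1727.1 (defining polynomial)] -/
theorem cubic_eq (hα : aeval α (poly 0 (-1) (-16)) = 0) : α ^ 3 - α - 16 = 0 := by
  have h := hα
  simp only [poly, map_add, map_mul, map_pow, aeval_X, eq_intCast, map_intCast] at h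
  push_cast at h
  linear_combination h

/-- **`δ = (α ^ 2 + α) / 2` is a root of `g`.** [cite: Marcus2018, Ch. 2, Exercise 27] -/
theorem delta_root (hα : aeval α (poly 0 (-1) (-16)) = 0) : aeval ((α ^ 2 + α) / 2) (poly (-1) (-12) (-32)) = 0 := by
  simp only [poly, map_add, map_mul, map_pow, aeval_X, eq_intCast, map_intCast]
  push_cast
  linear_combination (((2 : F)) + ((1 : F) / 4) * α + ((3 : F) / 8) * α ^ 2 + ((1 : F) / 8) * α ^ 3) * cubic_eq hα

/-- **`2 x ∈ ℤ[θ]` for every algebraic integer `x`** (`Δ(f) = 2²·(−1727)`, `−1727` squarefree, so `indexDet ∣ 2`). [cite: Marcus2018, Ch. 2, Exercise 27(c)] -/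
theorem mem2 (h3 : finrank ℚ F = 3) (hα : aeval α (poly 0 (-1) (-16)) = 0) (x : 𝓞 F) :
    ((2 : ℕ) : F) * x ∈ Algebra.adjoin ℤ ({α} : Set F) := by
  have h := mul_mem_adjoin_of_discr_eq_sq_mul (pb irreducible_polyQ hα h3) (isIntegral_pb_gen irreducible_polyQ hα h3) 2 (-1727)
    (by rw [discr_pb, disc_eq]) squarefree_neg_1727 x
  rw [pb_gen] at h
  exact_mod_cast h

/-- `p ∤ exponent(θ)` for every prime `p ≠ 2` (Dedekind–Kummer for `f` is available away from `2` only). [cite: Marcus2018, Ch. 3, Thm. 27] -/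
theorem not_dvd_exponent (h3 : finrank ℚ F = 3) (hα : aeval α (poly 0 (-1) (-16)) = 0) {p : ℕ} (hp : p.Prime) (hp2 : p ≠ 2) :
    ¬ p ∣ RingOfIntegers.exponent (thetaInt hα) :=
  MonicCubic.not_dvd_exponent hα (mem2 h3 hα) fun h =>
    hp2 ((Nat.prime_dvd_prime_iff_eq hp Nat.prime_two).mp h)

/-- **`2δ = θ² + θ`** in `𝓞 F`. [cite: Marcus2018, Ch. 2, Exercise 27] -/
theorem den_delta (hα : aeval α (poly 0 (-1) (-16)) = 0) :
    2 * thetaInt (delta_root hα) = thetaInt hα ^ 2 + thetaInt hα := by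
  rw [RingOfIntegers.ext_iff]
  simp only [map_mul, map_add, map_pow, map_ofNat, MonicCubic.thetaInt, RingOfIntegers.map_mk]
  ring

/-- **The multiplication table of `ℤ ⊕ ℤθ ⊕ ℤδ`**: `θ² = -θ + 2δ`, `θδ = 8 + δ`, `δ² = 8 + 4θ + δ` — so `ℤ[θ, δ] = ℤ ⊕ ℤθ ⊕ ℤδ` is a ring
(`= 𝓞_F`: it contains `ℤ[θ]` with index `2 = [𝓞_F : ℤ[θ]]`). [cite: Marcus2018, Ch. 2, Exercise 27] -/
theorem mul_table (hα : aeval α (poly 0 (-1) (-16)) = 0) :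
    thetaInt hα ^ 2 = -thetaInt hα + 2 * thetaInt (delta_root hα) ∧
    thetaInt hα * thetaInt (delta_root hα) = 8 + thetaInt (delta_root hα) ∧
    thetaInt (delta_root hα) ^ 2 = 8 + 4 * thetaInt hα + thetaInt (delta_root hα) := by
  refine ⟨?_, ?_, ?_⟩
  · rw [RingOfIntegers.ext_iff]
    simp only [map_mul, map_add, map_neg, map_pow, map_ofNat, MonicCubic.thetaInt, RingOfIntegers.map_mk]
    ring
  · rw [RingOfIntegers.ext_iff]
    simp only [map_mul, map_add, map_ofNat, MonicCubic.thetaInt, RingOfIntegers.map_mk]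
    linear_combination (((1 : F) / 2)) * cubic_eq hα
  · rw [RingOfIntegers.ext_iff]
    simp only [map_mul, map_add, map_pow, map_ofNat, MonicCubic.thetaInt, RingOfIntegers.map_mk]
    linear_combination (((1 : F) / 2) + ((1 : F) / 4) * α) * cubic_eq hα

/-- Coordinates: `a + bθ + cδ = a + (b + c/2)·α + (c/2)·α²` in `F`. [cite: Marcus2018, Ch. 2, Exercise 27] -/
theorem coe_lin (hα : aeval α (poly 0 (-1) (-16)) = 0) (a b c : ℤ) :
    (((a : 𝓞 F) + b * thetaInt hα + c * thetaInt (delta_root hα) : 𝓞 F) : F) =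
      ((a : ℚ) : F) + ((b + c / 2 : ℚ) : F) * α + ((c / 2 : ℚ) : F) * α ^ 2 := by
  simp only [map_add, map_mul, map_intCast, MonicCubic.thetaInt, RingOfIntegers.map_mk]
  push_cast
  ring

/-- ★ **The norm form on the integral basis**: `N(a + bθ + cδ) = a³ + a²c − ab² − 25abc − 12ac² + 16b³ + 24b²c + 8bc² + 32c³`
(the determinant of multiplication by `a + bθ + cδ` on `ℤ ⊕ ℤθ ⊕ ℤδ`; from `MonicCubic.norm_lin` and `coe_lin`).  This replaces the residue map at `2`
(unavailable: `2` divides every index) when a prime of norm `2` has to be certified. [cite: Marcus2018, Ch. 2, Thm. 4] -/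
theorem norm_lin3 (h3 : finrank ℚ F = 3) (hα : aeval α (poly 0 (-1) (-16)) = 0) (a b c : ℤ) :
    Algebra.norm ℤ (((a : 𝓞 F) + b * thetaInt hα + c * thetaInt (delta_root hα) : 𝓞 F)) =
      a ^ 3 + a ^ 2 * c - a * b ^ 2 - 25 * a * b * c - 12 * a * c ^ 2 + 16 * b ^ 3 + 24 * b ^ 2 * c + 8 * b * c ^ 2 + 32 * c ^ 3 := by
  have h := Algebra.coe_norm_int (((a : 𝓞 F) + b * thetaInt hα + c * thetaInt (delta_root hα) : 𝓞 F))
  rw [coe_lin hα a b c] at h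
  have hn := MonicCubic.norm_lin irreducible_polyQ hα h3 (a : ℚ) (b + c / 2 : ℚ) (c / 2 : ℚ)
  rw [hn, MonicCubic.normForm] at h
  have h' : ((Algebra.norm ℤ (((a : 𝓞 F) + b * thetaInt hα + c * thetaInt (delta_root hα) : 𝓞 F)) : ℤ) : ℚ)
      = ((a ^ 3 + a ^ 2 * c - a * b ^ 2 - 25 * a * b * c - 12 * a * c ^ 2 + 16 * b ^ 3 + 24 * b ^ 2 * c + 8 * b * c ^ 2 + 32 * c ^ 3 : ℤ) : ℚ) := by
    rw [h]; push_cast; ring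
  exact_mod_cast h'

/-- **`δ ∉ ℤ[θ]`**: if `(α² + α)/2 = p(α)` with `p ∈ ℤ[X]`, then `2·(p mod f) − (X² + X)` is a non-zero (odd `X²`-coefficient) polynomial of degree `≤ 2`
vanishing at `α`, contradicting `deg minpoly_ℚ(α) = 3`. [cite: Marcus2018, Ch. 2, Exercise 27] [cite: Dedekind1878, §5] -/
theorem not_mem_adjoin_delta (hα : aeval α (poly 0 (-1) (-16)) = 0) : (α ^ 2 + α) / 2 ∉ Algebra.adjoin ℤ ({α} : Set F) := by
  intro hmem
  rw [Algebra.adjoin_singleton_eq_range_aeval] at hmem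
  obtain ⟨p, hp⟩ := hmem
  have hmon : (poly 0 (-1) (-16)).Monic := monic_poly 0 (-1) (-16)
  set r : ℤ[X] := p %ₘ poly 0 (-1) (-16) with hr
  have hrval : aeval α r = (α ^ 2 + α) / 2 := by
    rw [hr, aeval_modByMonic_eq_self_of_root hα]
    exact hp
  have hrdeg : r.natDegree < 3 := by
    rw [← natDegree_poly 0 (-1) (-16)]
    exact natDegree_modByMonic_lt p hmon (by
      intro h1
      have := congrArg natDegree h1
      rw [natDegree_poly, natDegree_one] at this
      omega)
  -- the polynomial `Q = 2 r − (X² + X)` of degree ≤ 2 vanishes at `α`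
  set Q : ℤ[X] := C 2 * r - (X ^ 2 + X) with hQ
  have hQval : aeval α Q = 0 := by
    rw [hQ, map_sub, map_mul, aeval_C, hrval, map_add, map_pow, aeval_X, algebraMap_int_eq, eq_intCast]
    push_cast
    ring
  have hQdeg : Q.natDegree ≤ 2 := by
    rw [hQ]
    refine (natDegree_sub_le _ _).trans (max_le ?_ ?_)
    · exact (natDegree_C_mul_le 2 r).trans (by omega)
    · have : (X ^ 2 + X : ℤ[X]).natDegree ≤ 2 := by
        refine (natDegree_add_le _ _).trans (max_le ?_ ?_)
        · rw [natDegree_X_pow]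
        · exact natDegree_X_le.trans (by norm_num)
      exact this
  have hQ2 : Q.coeff 2 = 2 * r.coeff 2 - 1 := by
    rw [hQ, coeff_sub, coeff_C_mul, coeff_add, coeff_X_pow, coeff_X]
    norm_num
  have hQne : Q ≠ 0 := by
    intro h0
    have h2 := hQ2
    rw [h0, coeff_zero] at h2
    omega
  -- transport to `ℚ[X]` and compare with `minpoly ℚ α = f` of degree `3`
  set Qℚ : ℚ[X] := Q.map (Int.castRingHom ℚ) with hQℚ
  have hQℚne : Qℚ ≠ 0 := by
    rw [hQℚ, Ne, Polynomial.map_eq_zero_iff (RingHom.injective_int (Int.castRingHom ℚ))]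
    exact hQne
  have hQℚval : aeval α Qℚ = 0 := by
    rw [hQℚ, ← algebraMap_int_eq, aeval_map_algebraMap]
    exact hQval
  have hmin := minpoly.degree_le_of_ne_zero ℚ α hQℚne hQℚval
  rw [minpoly_rat_eq irreducible_polyQ hα, degree_eq_natDegree (monic_polyQ 0 (-1) (-16)).ne_zero, natDegree_polyQ,
    degree_eq_natDegree hQℚne] at hmin
  have hle : Qℚ.natDegree ≤ 2 := (natDegree_map_le).trans hQdeg
  have h3le : (3 : ℕ) ≤ Qℚ.natDegree := by exact_mod_cast hmin
  omega

/-- ★ **`d_F = −1727`.**  `Δ(f) = 2²·(−1727) = i²·d_F` with the index determinant `i ∣ 2`; `i` is not a unit (else `𝓞_F = ℤ[θ]` would contain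
`δ = (θ² + θ)/2`, `not_mem_adjoin_delta`), so `i = ±2` and `d_F = −1727`. [cite: LMFDB, number field 3.1.1727.1 (discriminant −1727)]
[cite: Marcus2018, Ch. 2, Exercise 27(c),(d)] -/
theorem discr_eq (h3 : finrank ℚ F = 3) (hα : aeval α (poly 0 (-1) (-16)) = 0) : discr F = -1727 := by
  have e1 := discr_powerBasis_eq_indexDet_sq_mul_discr (pb irreducible_polyQ hα h3) (isIntegral_pb_gen irreducible_polyQ hα h3)
  have hd1 := indexDet_dvd_of_discr_eq_sq_mul (pb irreducible_polyQ hα h3) (isIntegral_pb_gen irreducible_polyQ hα h3) 2 (-1727)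
    (by rw [discr_pb, disc_eq]) squarefree_neg_1727
  rw [discr_pb, disc_eq] at e1
  have hnu : ¬ IsUnit (indexDet (pb irreducible_polyQ hα h3) (isIntegral_pb_gen irreducible_polyQ hα h3)) := by
    intro hu
    have hmem := mem_adjoin_of_isUnit_indexDet (pb irreducible_polyQ hα h3) (isIntegral_pb_gen irreducible_polyQ hα h3) hu
      (thetaInt (delta_root hα))
    rw [pb_gen] at hmem
    exact not_mem_adjoin_delta hα (by simpa [MonicCubic.thetaInt] using hmem)
  set i1 := indexDet (pb irreducible_polyQ hα h3) (isIntegral_pb_gen irreducible_polyQ hα h3)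
  set d := discr F
  have z1 : (2 : ℤ) ^ 2 * (-1727) = i1 ^ 2 * d := by exact_mod_cast e1
  have habs : i1.natAbs = 2 := by
    have hdvd : i1.natAbs ∣ 2 := by
      have := Int.natAbs_dvd_natAbs.mpr hd1
      simpa using this
    rcases (Nat.dvd_prime Nat.prime_two).mp hdvd with h1 | h2
    · exact absurd (Int.isUnit_iff_natAbs_eq.mpr h1) hnu
    · exact h2
  have hsq : i1 ^ 2 = 4 := by
    rw [sq, ← Int.natAbs_mul_self, habs]; norm_num
  rw [hsq] at z1
  have : (4 : ℤ) * d = 4 * (-1727) := by linear_combination -z1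
  exact mul_left_cancel₀ (by norm_num) this

/-- **`F` has exactly one complex place** (`r₂ = 1`): `d_F < 0` has sign `(−1)^{r₂}`, and `r₁ + 2r₂ = 3`. [cite: LMFDB, number field 3.1.1727.1 (signature [1,1])] -/
theorem nrComplexPlaces_eq_one (h3 : finrank ℚ F = 3) (hα : aeval α (poly 0 (-1) (-16)) = 0) : nrComplexPlaces F = 1 := by
  have hsum := card_add_two_mul_card_eq_rank F
  rw [h3] at hsum
  have hsign := NumberField.sign_discr F
  rw [discr_eq h3 hα] at hsign
  have hle : nrComplexPlaces F ≤ 1 := by omega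
  rcases Nat.le_one_iff_eq_zero_or_eq_one.mp hle with h0 | h1
  · rw [h0, pow_zero, show (-1727 : ℤ).sign = -1 from rfl] at hsign
    norm_num at hsign
  · exact h1

end NumberField

end Literature.NumberTheory.CubicFields.CubicDisc1727

end
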